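import Summits.ValiantsHypothesis.ValiantsHypothesis.Theorems.SymPencilPerFourPeeledTwoPencilSigmaZero

/-!
# Route `SymPencil` — inner rank of the `2 | 2` row split of `per_4`, PEELED case: the GENERAL
# Σ₀ two-pencil frame (`--supports` stmt-ValiantsHypothesis-5674 `SdcSuperquadratic`; (8,8) column,
# memo `NOTE-p8g15-5674-R2-two-pencil.md` §3/§7; rung currency only)

The Σ₀ geometry of the memo made formal for ARBITRARY `z₀, z₁ ∈ 𝟙^⊥`.  With `U = J - 2I` and
`𝐇(z) = [-(z_b + z_l)]_{b ≠ l}` (the Hessian `[per(𝟙; e_b; z; e_l)]` when `Σ z = 0`):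
`U 𝐇(z) = 2 D_z U` (`hess_U_mul`), `𝐇(z) U_j = 2 z_j U_j` (`hess_eig`), and the transport
`[per(a; e_b; a∘z; e_l)] = (Π a) D_a⁻¹ 𝐇(z) D_a⁻¹` (`transport`).  Hence for a reduced peeled family,
`a₀` with non-zero coordinates, `a₁`, and `z₀, z₁` with `Σ z_i = 0`, `z₀` all-non-zero and pairwise
distinct ratios `z₁/z₀`, the frame `y_i = a₀ ∘ z_i` has EXPLICIT two-pencil data —
`W₀ = (8 Π a₀)⁻¹ D U D_{z₀}⁻¹ U D`, eigenvectors `a₀ ∘ U_j`, eigenvalues `z₁ⱼ/z₀ⱼ`, `W = ¼ D⁻¹ U` — and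
**`false_of_sigma0_frame`**: if moreover `ψ(a_j, a₀∘z_i) = 0` (four scalar conditions) and
`Q = P₁₁ - P₁₀ W₀ P₀₁ ≠ 0`, then `|κ| ≤ 11` is contradictory (`…TwoPencilDesign.false_of_frame`).
What a Σ₀ frame-CLASS file must still do: exhibit `z₀, z₁` in the constraint plane
`(a₀∘Ψᵀa₀, a₀∘Ψᵀa₁, 𝟙)^⊥` and prove `Q ≠ 0` (linear in `a₁`, memo §7).

Honest framing: infrastructure for the frame-existence case analysis of HR2(11); no cell closes
here; the window of record, the crux `SdcSuperquadratic` and `VP ≠ VNP` are untouched.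
No definitions, no named facts. [folklore]
-/

noncomputable section

-- single-conjunct layout: Sub = Summit, duplicated namespace component intended
set_option linter.dupNamespace false

namespace Summit.ValiantsHypothesis.ValiantsHypothesis.Theorems.SymPencilPerFourPeeledTwoPencilSigmaZeroGeneral

open Matrix Finset Module
open Summit.ValiantsHypothesis.ValiantsHypothesis.Theorems.SymPencilPerFourInnerRankRows
open Summit.ValiantsHypothesis.ValiantsHypothesis.Theorems.SymPencilPerFourPeeledTwoPencilDesign
open Summit.ValiantsHypothesis.ValiantsHypothesis.Theorems.SymPencilPerFourPeeledTwoPencilSigmaZero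

universe u v

variable {K : Type u} [Field K]

/-- `U 𝐇(z) = 2 D_z U` for `Σ z = 0` (`U = J - 2I`), entrywise. [folklore] -/
theorem hess_U_mul (z : Fin 4 → K) (hσ : z 0 + z 1 + z 2 + z 3 = 0) :
    (Matrix.of ![![-1, 1, 1, 1], ![1, -1, 1, 1], ![1, 1, -1, 1], ![1, 1, 1, -1]] :
        Matrix (Fin 4) (Fin 4) K) *
      (Matrix.of fun b l : Fin 4 => if b = l then (0 : K) else -(z b + z l)) =
      (2 : K) • (Matrix.diagonal z *
        (Matrix.of ![![-1, 1, 1, 1], ![1, -1, 1, 1], ![1, 1, -1, 1], ![1, 1, 1, -1]] :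
          Matrix (Fin 4) (Fin 4) K)) := by
  have h3 : z 3 = -(z 0 + z 1 + z 2) := by linear_combination hσ
  ext b l
  fin_cases b <;> fin_cases l <;>
    simp [Matrix.mul_apply, Fin.sum_univ_four, h3] <;> ring

/-- `𝐇(z) U_j = 2 z_j U_j` for `Σ z = 0`. [folklore] -/
theorem hess_eig (z : Fin 4 → K) (hσ : z 0 + z 1 + z 2 + z 3 = 0) (j : Fin 4) :
    (Matrix.of fun b l : Fin 4 => if b = l then (0 : K) else -(z b + z l)) *ᵥ
        ((Matrix.of ![![-1, 1, 1, 1], ![1, -1, 1, 1], ![1, 1, -1, 1], ![1, 1, 1, -1]] :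
          Matrix (Fin 4) (Fin 4) K) j) =
      (2 * z j) • (Matrix.of ![![-1, 1, 1, 1], ![1, -1, 1, 1], ![1, 1, -1, 1], ![1, 1, 1, -1]] :
          Matrix (Fin 4) (Fin 4) K) j := by
  have h3 : z 3 = -(z 0 + z 1 + z 2) := by linear_combination hσ
  fin_cases j <;>
    (funext k; fin_cases k <;> simp [Matrix.mulVec, dotProduct, Fin.sum_univ_four, h3] <;> ring)

/-- **Transport**: `[per(a; e_b; a∘z; e_l)] = (Π a) · D_a⁻¹ 𝐇(z) D_a⁻¹` for `a` with non-zero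
coordinates and `Σ z = 0`. [folklore] -/
theorem transport (a z : Fin 4 → K) (ha : ∀ k, a k ≠ 0) (hσ : z 0 + z 1 + z 2 + z 3 = 0) :
    (Matrix.of fun b l : Fin 4 =>
        (Matrix.of ![a, Pi.single b (1 : K), (fun k => a k * z k), Pi.single l 1]).permanent) =
      (a 0 * a 1 * a 2 * a 3) • (Matrix.diagonal (fun k => (a k)⁻¹) *
        (Matrix.of fun b l : Fin 4 => if b = l then (0 : K) else -(z b + z l)) *
        Matrix.diagonal (fun k => (a k)⁻¹)) := by
  ext b l
  rw [Matrix.of_apply, per_single_had_div a z ha b l, Matrix.smul_apply, smul_eq_mul,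
    Matrix.mul_diagonal, Matrix.diagonal_mul, Matrix.of_apply, hσ]
  have hb := ha b; have hl := ha l
  split_ifs <;> field_simp <;> ring

/-- **The general Σ₀ frame.**  See the module docstring. [folklore] -/
theorem false_of_sigma0_frame [CharZero K] {κ : Type v} [Fintype κ] [DecidableEq κ]
    (hκ : Fintype.card κ ≤ 11) (c : κ → K)
    (t : κ → (((Fin 4 → K) × (Fin 4 → K)) →ₗ[K] ((Fin 4 → K) × (Fin 4 → K)) →ₗ[K] K))
    (hJ : ∀ a b y₂ y₃ : Fin 4 → K,
      ∑ r, c r * (t r (a, b) (y₂, y₃)) ^ 2 = (Matrix.of ![a, b, y₂, y₃]).permanent)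
    (v₀ v₀' : κ → K) (hv₀ : ∀ (a x : Fin 4 → K), ∃ s : K, (fun r => t r (a, 0) (x, 0)) = s • v₀)
    (hv₀' : ∀ (b x : Fin 4 → K), ∃ s : K, (fun r => t r (0, b) (0, x)) = s • v₀')
    (hpeel : ∃ a b y z : Fin 4 → K, ∑ r, c r * t r (a, 0) (y, 0) * t r (0, b) (0, z) ≠ 0)
    (a₀ a₁ z₀ z₁ : Fin 4 → K) (ha : ∀ k, a₀ k ≠ 0)
    (hσ₀ : z₀ 0 + z₀ 1 + z₀ 2 + z₀ 3 = 0) (hσ₁ : z₁ 0 + z₁ 1 + z₁ 2 + z₁ 3 = 0)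
    (hz : ∀ k, z₀ k ≠ 0) (hdist : ∀ i j, i ≠ j → z₁ i * z₀ j ≠ z₁ j * z₀ i)
    (hψ₀₀ : ∀ r, t r (a₀, 0) ((fun k => a₀ k * z₀ k), 0) = 0)
    (hψ₀₁ : ∀ r, t r (a₀, 0) ((fun k => a₀ k * z₁ k), 0) = 0)
    (hψ₁₀ : ∀ r, t r (a₁, 0) ((fun k => a₀ k * z₀ k), 0) = 0)
    (hψ₁₁ : ∀ r, t r (a₁, 0) ((fun k => a₀ k * z₁ k), 0) = 0)
    (hQ : (Matrix.of fun b l : Fin 4 =>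
          (Matrix.of ![a₁, Pi.single b (1 : K), (fun k => a₀ k * z₁ k), Pi.single l 1]).permanent) -
        (Matrix.of fun b l : Fin 4 =>
          (Matrix.of ![a₀, Pi.single b (1 : K), (fun k => a₀ k * z₁ k), Pi.single l 1]).permanent) *
        ((8 * (a₀ 0 * a₀ 1 * a₀ 2 * a₀ 3))⁻¹ • (Matrix.diagonal a₀ *
          (Matrix.of ![![-1, 1, 1, 1], ![1, -1, 1, 1], ![1, 1, -1, 1], ![1, 1, 1, -1]] :
            Matrix (Fin 4) (Fin 4) K) * Matrix.diagonal (fun k => (z₀ k)⁻¹) *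
          (Matrix.of ![![-1, 1, 1, 1], ![1, -1, 1, 1], ![1, 1, -1, 1], ![1, 1, 1, -1]] :
            Matrix (Fin 4) (Fin 4) K) * Matrix.diagonal a₀)) *
        (Matrix.of fun b l : Fin 4 =>
          (Matrix.of ![a₁, Pi.single b (1 : K), (fun k => a₀ k * z₀ k), Pi.single l 1]).permanent)
        ≠ 0) : False := by
  -- names
  let U : Matrix (Fin 4) (Fin 4) K :=
    Matrix.of ![![-1, 1, 1, 1], ![1, -1, 1, 1], ![1, 1, -1, 1], ![1, 1, 1, -1]]
  let H : (Fin 4 → K) → Matrix (Fin 4) (Fin 4) K :=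
    fun z => Matrix.of fun b l : Fin 4 => if b = l then (0 : K) else -(z b + z l)
  let y₀ : Fin 4 → K := fun k => a₀ k * z₀ k
  let y₁ : Fin 4 → K := fun k => a₀ k * z₁ k
  let P₀₀ : Matrix (Fin 4) (Fin 4) K :=
    Matrix.of fun b l => (Matrix.of ![a₀, Pi.single b 1, y₀, Pi.single l 1]).permanent
  let P₁₀ : Matrix (Fin 4) (Fin 4) K :=
    Matrix.of fun b l => (Matrix.of ![a₀, Pi.single b 1, y₁, Pi.single l 1]).permanent
  let P₀₁ : Matrix (Fin 4) (Fin 4) K :=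
    Matrix.of fun b l => (Matrix.of ![a₁, Pi.single b 1, y₀, Pi.single l 1]).permanent
  let P₁₁ : Matrix (Fin 4) (Fin 4) K :=
    Matrix.of fun b l => (Matrix.of ![a₁, Pi.single b 1, y₁, Pi.single l 1]).permanent
  set pa : K := a₀ 0 * a₀ 1 * a₀ 2 * a₀ 3 with hpa
  have hpa0 : pa ≠ 0 := by
    rw [hpa]; exact mul_ne_zero (mul_ne_zero (mul_ne_zero (ha 0) (ha 1)) (ha 2)) (ha 3)
  let D : Matrix (Fin 4) (Fin 4) K := Matrix.diagonal a₀
  let Di : Matrix (Fin 4) (Fin 4) K := Matrix.diagonal fun k => (a₀ k)⁻¹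
  let Dz : Matrix (Fin 4) (Fin 4) K := Matrix.diagonal z₀
  let Dzi : Matrix (Fin 4) (Fin 4) K := Matrix.diagonal fun k => (z₀ k)⁻¹
  have hDDi : D * Di = 1 := by
    rw [Matrix.diagonal_mul_diagonal, ← Matrix.diagonal_one]
    congr 1; funext k; exact mul_inv_cancel₀ (ha k)
  have hDiD : Di * D = 1 := by
    rw [Matrix.diagonal_mul_diagonal, ← Matrix.diagonal_one]
    congr 1; funext k; exact inv_mul_cancel₀ (ha k)
  have hDziDz : Dzi * Dz = 1 := by
    rw [Matrix.diagonal_mul_diagonal, ← Matrix.diagonal_one]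
    congr 1; funext k; exact inv_mul_cancel₀ (hz k)
  have hUU : U * U = (4 : K) • (1 : Matrix (Fin 4) (Fin 4) K) := numU_sq
  -- transports
  have T0 : P₀₀ = pa • (Di * H z₀ * Di) := transport a₀ z₀ ha hσ₀
  have T1 : P₁₀ = pa • (Di * H z₁ * Di) := transport a₀ z₁ ha hσ₁
  -- W₀
  let W₀ : Matrix (Fin 4) (Fin 4) K := (8 * pa)⁻¹ • (D * U * Dzi * U * D)
  have hUH : U * H z₀ = (2 : K) • (Dz * U) := hess_U_mul z₀ hσ₀
  have hW₀ : W₀ * P₀₀ = 1 := by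
    show ((8 * pa)⁻¹ • (D * U * Dzi * U * D)) * P₀₀ = 1
    rw [T0, Matrix.smul_mul, Matrix.mul_smul, smul_smul]
    have e : D * U * Dzi * U * D * (Di * H z₀ * Di) = (8 : K) • (1 : Matrix (Fin 4) (Fin 4) K) := by
      calc D * U * Dzi * U * D * (Di * H z₀ * Di)
          = D * U * Dzi * (U * ((D * Di) * H z₀)) * Di := by simp only [Matrix.mul_assoc]
        _ = D * U * Dzi * ((2 : K) • (Dz * U)) * Di := by rw [hDDi, Matrix.one_mul, hUH]
        _ = (2 : K) • (D * U * (Dzi * Dz) * U * Di) := by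
              simp only [Matrix.mul_smul, Matrix.smul_mul, Matrix.mul_assoc]
        _ = (2 : K) • (D * (U * U) * Di) := by rw [hDziDz, Matrix.mul_one]; simp only [Matrix.mul_assoc]
        _ = (8 : K) • (1 : Matrix (Fin 4) (Fin 4) K) := by
              rw [hUU, Matrix.mul_smul, Matrix.smul_mul, Matrix.mul_one, hDDi, smul_smul]; norm_num
    rw [e, smul_smul]
    have : (8 * pa)⁻¹ * pa * 8 = (1 : K) := by field_simp
    rw [this, one_smul]
  -- eigen-data
  let v : Fin 4 → Fin 4 → K := fun j k => a₀ k * U j k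
  let s : Fin 4 → K := fun j => z₁ j / z₀ j
  have hvD : ∀ j, v j = D *ᵥ U j := fun j => by
    funext k; simp [v, D, Matrix.mulVec_diagonal]
  have hHU0 : ∀ j, H z₀ *ᵥ U j = (2 * z₀ j) • U j := fun j => hess_eig z₀ hσ₀ j
  have hHU1 : ∀ j, H z₁ *ᵥ U j = (2 * z₁ j) • U j := fun j => hess_eig z₁ hσ₁ j
  have hsz : ∀ j, s j * z₀ j = z₁ j := fun j => div_mul_cancel₀ (z₁ j) (hz j)
  have hDD : ∀ M : Matrix (Fin 4) (Fin 4) K, Di * M * Di * D = Di * M := fun M => by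
    rw [Matrix.mul_assoc, hDiD, Matrix.mul_one]
  have hv : ∀ j, P₁₀ *ᵥ v j = s j • P₀₀ *ᵥ v j := by
    intro j
    rw [T0, T1, hvD, Matrix.smul_mulVec, Matrix.smul_mulVec, Matrix.mulVec_mulVec,
      Matrix.mulVec_mulVec, hDD, hDD, ← Matrix.mulVec_mulVec, ← Matrix.mulVec_mulVec, hHU0, hHU1,
      Matrix.mulVec_smul, Matrix.mulVec_smul, smul_smul, smul_smul, smul_smul, ← hsz j]
    congr 1
    ring
  have hs : ∀ i j, i ≠ j → s i ≠ s j := by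
    intro i j hij h
    apply hdist i j hij
    have h' : z₁ i / z₀ i = z₁ j / z₀ j := h
    rw [div_eq_div_iff (hz i) (hz j)] at h'
    exact h'
  let W : Matrix (Fin 4) (Fin 4) K := (4 : K)⁻¹ • (Di * U)
  have hW : W * Matrix.of v = 1 := by
    have hofv : Matrix.of v = U * D := by
      ext i k; simp [v, D, Matrix.mul_diagonal, mul_comm]
    show ((4 : K)⁻¹ • (Di * U)) * Matrix.of v = 1
    rw [hofv, Matrix.smul_mul, Matrix.mul_assoc, ← Matrix.mul_assoc U U, hUU, Matrix.smul_mul,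
      Matrix.one_mul, Matrix.mul_smul, hDiD, smul_smul]
    have : (4 : K)⁻¹ * 4 = 1 := by field_simp
    rw [this, one_smul]
  exact false_of_frame hκ c t hJ v₀ v₀' hv₀ hv₀' hpeel a₀ a₁ y₀ y₁
    hψ₀₀ hψ₀₁ hψ₁₀ hψ₁₁ P₀₀ P₁₀ P₀₁ P₁₁
    (fun b l => rfl) (fun b l => rfl) (fun b l => rfl) (fun b l => rfl) W₀ hW₀ v s hv hs W hW hQ

end Summit.ValiantsHypothesis.ValiantsHypothesis.Theorems.SymPencilPerFourPeeledTwoPencilSigmaZeroGeneral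

end
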